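import Mathlib
import Literature.Probability.Percolation.HarrisTheorem
import Literature.Probability.Percolation.CrossingChains
import Literature.Probability.Percolation.SiteMonotonicity
import Literature.Probability.Percolation.ClusterOuterBoundary
import Literature.Probability.Percolation.FKLoopWindingCells
import Literature.Probability.Percolation.LoopRepresentation
import HarnessLib

/-!
# Lattice dust density (Dlat), bond-`ℤ²` half at the origin: a large type-`1` medial loop at one of
# many scales

Crux `Summit.CriticalPhenomena.CardyFormulaZ2.Theses.CardyMagicRigidity.NestingRigidity`
(stmt-CriticalPhenomena-4835), line `positive-cone-weight-doubling`, toward the registered stub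
`latticeDust_latticeEnsembles` (lattice dust density of both lattice ensembles; the site-`𝕋` half is
`latticeDust_local_tEns`, …LatticeDustT).  This brick is the bond-`ℤ²` RSW layer about the ORIGIN, in
lattice units (registered anchor `latticeDust_bond_origin`): there is `p₀ ∈ (0, 1]` such that for every
base scale `a₀ ≥ 1` and every number of scales `K`, off an event of `P_{1/2}`-probability
`≤ (1 - p₀)^K`, every lattice configuration has, at every mesh `δ > 0`, a member of TYPE `1` of its typed
loop representation `bondLoopConfig δ 0 ω` with trace in `B(0, 20 a₀ 16^K δ)` and diameter `≥ a₀ δ / 2`.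

* §1 the scale-`a` event: an open left–right crossing of the `a × a` square `[a, 2a] × [0, a]`
  (`lrCrossingAt`) together with the blocked square annulus `{2a + 1 ≤ ‖z‖_∞ ≤ 6a + 3}`
  (`annulusBlocked (2a+1)`, `HarrisTheorem.lean`); the two live on disjoint bond sets, so the event has
  probability `≥ ½ · c⁴ =: p₀` (`half_le_crossingProb_self`, `pow_four_le_real_annulusBlocked` with the
  RSW constant of `rsw_lowerBound_holds`), and it is determined by the bonds of `{a ≤ ‖z‖_∞ ≤ 6a + 3}`;
* §2 the events at the scales `a₀ 16^k`, `k < K`, are independent (disjoint bond sets,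
  `bondPercolation_real_inter_of_disjoint`), so all fail with probability `≤ (1 - p₀)^K`;
* §3 deterministic: on the scale-`a` event the open cluster of the crossing is confined to the open box
  `(-6a-3, 6a+3)²` (`openConnIn_box_of_annulusBlocked`), hence finite; its outer boundary is a type-`1`
  interface loop winding once about the cluster (`exists_isInterfaceLoop_around_openCluster`), in
  particular about the two ends of the crossing (at distance `≥ a`), and a loop winding about two points
  at distance `D` has diameter `≥ D/2`.
-/

noncomputable section

open MeasureTheory Set Filter Metric
open scoped Topology ENNReal NNReal unitInterval

namespace Summit.CriticalPhenomena.CardyFormulaZ2.Cruxes.NestingRigidity.PositiveConeWeightDoubling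

open Literature.Probability.RandomPlanarGeometry Literature.Probability.Percolation
  Literature.Probability.LatticeModels

/-- The scale-`a` dust event at the origin: an open left–right crossing of `[a, 2a] × [0, a]` and the
blocked annulus `{2a+1 ≤ ‖z‖_∞ ≤ 6a+3}` (local notation, not a definition). -/
local notation3 "DustEv(" a ")" =>
  lrCrossingAt ![((a : ℕ) : ℤ), 0] a a ∩ annulusBlocked (2 * a + 1)

/-- The bonds of the region `{a ≤ ‖z‖_∞ ≤ 6a + 3}` carrying the scale-`a` event (local notation). -/
local notation3 "DustBonds(" a ")" =>
  ((annulus 2 ((a : ℕ) - 1) (3 * (2 * a + 1))).sym2 : Finset (Sym2 (Site 2)))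

/-! ## §1 The scale-`a` event: locality, measurability, probability -/

/-- Bonds of a box and bonds of an annulus outside that box are disjoint. -/
theorem latticeDust_disjoint_sym2_box_annulus (m M : ℕ) :
    Disjoint (↑((box 2 m).sym2) : Set (Sym2 (Site 2))) ↑((annulus 2 m M).sym2) := by
  rw [Finset.disjoint_coe, Finset.disjoint_left]
  intro e he he'
  induction e using Sym2.ind with
  | h x y =>
    rw [Finset.mk_mem_sym2_iff] at he he'
    exact (mem_annulus.1 he'.1).2 he.1

/-- The scale-`a` event is measurable. -/
theorem latticeDust_measurableSet_dustEv (a : ℕ) : MeasurableSet (DustEv(a)) :=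
  (measurableSet_lrCrossingAt _ _ _).inter (measurableSet_annulusBlocked _)

/-- The crossing part of the scale-`a` event is determined by the bonds of the box `B(2a)`. -/
theorem latticeDust_determinedBy_lrCrossingAt (a : ℕ) :
    DeterminedBy (lrCrossingAt ![((a : ℕ) : ℤ), 0] a a) ↑((box 2 (2 * a)).sym2) := by
  refine (determinedBy_openCrossing_image (rectangle a a) _ _ _).mono
    (Finset.coe_subset.2 (Finset.sym2_mono fun z hz ↦ ?_))
  obtain ⟨b, hb, rfl⟩ := Finset.mem_image.1 hz
  rw [mem_rectangle_iff] at hb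
  simp only [mem_box, Fin.forall_fin_two, Pi.add_apply, Matrix.cons_val_zero, Matrix.cons_val_one]
  push_cast
  omega

/-- **The scale-`a` event is determined by the bonds of `{a ≤ ‖z‖_∞ ≤ 6a + 3}`** (`a ≥ 1`). -/
theorem latticeDust_determinedBy_dustEv {a : ℕ} (ha : 1 ≤ a) : DeterminedBy (DustEv(a)) ↑(DustBonds(a)) := by
  refine DeterminedBy.inter ?_ ((determinedBy_annulusBlocked (by omega)).mono
    (Finset.coe_subset.2 (Finset.sym2_mono fun z hz ↦ ?_)))
  · refine (determinedBy_openCrossing_image (rectangle a a) _ _ _).mono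
      (Finset.coe_subset.2 (Finset.sym2_mono fun z hz ↦ ?_))
    obtain ⟨b, hb, rfl⟩ := Finset.mem_image.1 hz
    rw [mem_rectangle_iff] at hb
    simp only [mem_annulus, mem_box, Fin.forall_fin_two, Pi.add_apply, Matrix.cons_val_zero,
      Matrix.cons_val_one, not_and_or, not_le]
    push_cast
    omega
  · rw [mem_annulus, mem_box, mem_box] at hz ⊢
    refine ⟨hz.1, fun h ↦ hz.2 fun i ↦ ?_⟩
    have := h i
    omega

/-- **The scale-`a` event has probability at least `p₀ = c⁴/2`**, uniformly in `a ≥ 1`: the crossing of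
the `a × a` square has probability `≥ 1/2` (`half_le_crossingProb_self`), the blocked annulus `≥ c⁴`
(`pow_four_le_real_annulusBlocked` and the RSW constant `c` of `rsw_lowerBound_holds`), and the two are
independent (disjoint bonds). -/
theorem latticeDust_exists_le_real_dustEv : ∃ p₀ : ℝ, 0 < p₀ ∧ p₀ ≤ 1 ∧ ∀ a : ℕ, 1 ≤ a →
    p₀ ≤ (bondPercolation (zdGraph 2) half).real (DustEv(a)) := by
  obtain ⟨c, hc, hcn⟩ := rsw_lowerBound_holds.le_one_sub_crossingProb
  have hc1 : c ≤ 1 := (hcn 1 le_rfl).trans (by linarith [(crossingProb_mem_Icc half 2 6).1])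
  refine ⟨c ^ 4 / 2, by positivity, by nlinarith [pow_le_one₀ hc.le hc1 (n := 4)], fun a ha ↦ ?_⟩
  have hind := bondPercolation_real_inter_of_disjoint (zdGraph 2) half
    (latticeDust_disjoint_sym2_box_annulus (2 * a) (3 * (2 * a + 1)))
    (latticeDust_determinedBy_lrCrossingAt a)
    (by simpa using determinedBy_annulusBlocked (n := 2 * a + 1) (by omega))
    (measurableSet_lrCrossingAt _ _ _) (measurableSet_annulusBlocked _)
  rw [hind, bondPercolation_real_lrCrossingAt]
  have h1 : 1 / 2 ≤ crossingProb half a a := half_le_crossingProb_self crossingProb_half_succ_self_holds a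
  have h2 : c ^ 4 ≤ (bondPercolation (zdGraph 2) half).real (annulusBlocked (2 * a + 1)) :=
    (pow_le_pow_left₀ hc.le (hcn (2 * a + 1) (by omega)) 4).trans (pow_four_le_real_annulusBlocked half _)
  calc c ^ 4 / 2 = 1 / 2 * c ^ 4 := by ring
    _ ≤ _ := mul_le_mul h1 h2 (by positivity) (crossingProb_mem_Icc half a a).1

/-! ## §2 Many scales: independence -/

/-- The failures of the events at the scales `a₀ 16^k`, `k < K`, are determined by the bonds of the box
`B(a₀ 16^K - 1)`. -/
theorem latticeDust_determinedBy_iInter_compl {a₀ : ℕ} (ha₀ : 1 ≤ a₀) (K : ℕ) :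
    DeterminedBy (⋂ k ∈ Finset.range K, (DustEv(a₀ * 16 ^ k))ᶜ) ↑((box 2 (a₀ * 16 ^ K - 1)).sym2) := by
  induction K with
  | zero => simpa using determinedBy_univ _
  | succ K ih =>
    rw [Finset.range_add_one, Finset.set_biInter_insert]
    have hpos : 1 ≤ a₀ * 16 ^ K := Nat.one_le_iff_ne_zero.2 (by positivity)
    refine DeterminedBy.inter ((latticeDust_determinedBy_dustEv hpos).compl.mono ?_) (ih.mono ?_)
    · refine Finset.coe_subset.2 (Finset.sym2_mono fun z hz ↦ ?_)
      rw [mem_annulus] at hz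
      rw [mem_box] at hz ⊢
      intro i
      have := hz.1 i
      have h16 : a₀ * 16 ^ (K + 1) = 16 * (a₀ * 16 ^ K) := by ring
      omega
    · refine Finset.coe_subset.2 (Finset.sym2_mono fun z hz ↦ ?_)
      rw [mem_box] at hz ⊢
      intro i
      have := hz i
      have h16 : a₀ * 16 ^ (K + 1) = 16 * (a₀ * 16 ^ K) := by ring
      omega

/-- The failures at the scales `a₀ 16^k`, `k < K`, form a measurable event. -/
theorem latticeDust_measurableSet_iInter_compl (a₀ K : ℕ) :
    MeasurableSet (⋂ k ∈ Finset.range K, (DustEv(a₀ * 16 ^ k))ᶜ) :=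
  Finset.measurableSet_biInter _ fun _ _ ↦ (latticeDust_measurableSet_dustEv _).compl

/-- **All `K` scales fail with probability `≤ (1 - p₀)^K`** (independence of the disjoint annuli
`{a ≤ ‖z‖_∞ ≤ 6a+3}`, `a = a₀ 16^k`, `bondPercolation_real_inter_of_disjoint`, inductively). -/
theorem latticeDust_real_iInter_compl_le {p₀ : ℝ}
    (hp : ∀ a : ℕ, 1 ≤ a → p₀ ≤ (bondPercolation (zdGraph 2) half).real (DustEv(a)))
    {a₀ : ℕ} (ha₀ : 1 ≤ a₀) (K : ℕ) :
    (bondPercolation (zdGraph 2) half).real (⋂ k ∈ Finset.range K, (DustEv(a₀ * 16 ^ k))ᶜ) ≤ (1 - p₀) ^ K := by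
  induction K with
  | zero => simp
  | succ K ih =>
    have hpos : 1 ≤ a₀ * 16 ^ K := Nat.one_le_iff_ne_zero.2 (by positivity)
    rw [Finset.range_add_one, Finset.set_biInter_insert, Set.inter_comm, pow_succ]
    have hdisj : Disjoint (↑((box 2 (a₀ * 16 ^ K - 1)).sym2) : Set (Sym2 (Site 2))) ↑(DustBonds(a₀ * 16 ^ K)) :=
      latticeDust_disjoint_sym2_box_annulus _ _
    rw [bondPercolation_real_inter_of_disjoint (zdGraph 2) half hdisj
      (latticeDust_determinedBy_iInter_compl ha₀ K) (latticeDust_determinedBy_dustEv hpos).compl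
      (latticeDust_measurableSet_iInter_compl a₀ K) (latticeDust_measurableSet_dustEv _).compl,
      measureReal_compl (latticeDust_measurableSet_dustEv _), probReal_univ]
    have h0 : 0 ≤ 1 - (bondPercolation (zdGraph 2) half).real (DustEv(a₀ * 16 ^ K)) := by
      linarith [measureReal_le_one (μ := bondPercolation (zdGraph 2) half) (s := DustEv(a₀ * 16 ^ K))]
    exact mul_le_mul ih (by linarith [hp _ hpos]) h0 (le_trans measureReal_nonneg ih)


/-! ## §3 Deterministic: the scale-`a` event forces a large type-`1` loop near the origin -/

/-- **A loop class winding about two points has diameter at least half their distance**: if a curve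
class winds non-trivially about `p` and about `q`, then `dist p q ≤ 2 · diam (trace)`
(`CurveClass.wind_eq_zero_of_subset_ball`). -/
theorem latticeDust_dist_le_two_mul_diam_range (c : CurveClass ℂ) {p q : ℂ} (hp : c.wind p ≠ 0)
    (hq : c.wind q ≠ 0) : dist p q ≤ 2 * diam c.range := by
  obtain ⟨z₀, hz₀⟩ := c.range_nonempty
  have hbdd := c.isCompact_range.isBounded
  have hsub : ∀ ε : ℝ, 0 < ε → c.range ⊆ ball z₀ (diam c.range + ε) := fun ε hε y hy ↦
    mem_ball.2 (lt_of_le_of_lt (dist_le_diam_of_mem hbdd hy hz₀) (lt_add_of_pos_right _ hε))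
  have hpz : dist p z₀ ≤ diam c.range := le_of_forall_pos_lt_add fun ε hε ↦
    not_le.1 fun h ↦ hp (c.wind_eq_zero_of_subset_ball (hsub ε hε) h)
  have hqz : dist q z₀ ≤ diam c.range := le_of_forall_pos_lt_add fun ε hε ↦
    not_le.1 fun h ↦ hq (c.wind_eq_zero_of_subset_ball (hsub ε hε) h)
  linarith [dist_triangle_right p q z₀]

/-- **On the scale-`a` event, a large type-`1` loop near the origin.**  For a lattice configuration in
`DustEv(a)` (`a ≥ 1`) and every mesh `δ > 0`, some member of type `1` of `bondLoopConfig δ 0 ω` has its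
trace in `B(0, (12a + 7)δ)` and diameter `≥ aδ/2`: the outer boundary of the (confined, finite) open
cluster of the crossing of `[a, 2a] × [0, a]`. -/
theorem latticeDust_typeOne_of_dustEv {ω : BondConfig (Site 2)} (hω : ω ⊆ (zdGraph 2).edgeSet) {a : ℕ}
    (ha : 1 ≤ a) (hE : ω ∈ DustEv(a)) {δ : ℝ} (hδ : 0 < δ) :
    ∃ u ∈ (bondLoopConfig δ 0 ω).F 1,
      u.range ⊆ ball (0 : ℂ) (δ * (12 * a + 7)) ∧ δ * a ≤ 2 * diam u.range := by
  classical
  obtain ⟨hLR, hB⟩ := hE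
  obtain ⟨x, y, T, hx0, hy0, hTs, hTe⟩ := exists_walk_of_mem_lrCrossingAt hω hLR
  simp only [Matrix.cons_val_zero, Matrix.cons_val_one] at hx0 hy0 hTs
  have hxs := hTs x T.start_mem_support
  -- the cluster of `x` contains `y` and is confined to the open box `(-3n, 3n)²`, `n = 2a + 1`
  have hyC : y ∈ openCluster ω x :=
    reachable_fromEdgeSet_of_edges_subset T hTe T.start_mem_support T.end_mem_support
  have hxbox : x ∈ box 2 (2 * a + 1) := by
    rw [mem_box, Fin.forall_fin_two]; push_cast; omega
  have hconf : ∀ v ∈ openCluster ω x, ∀ i, -(3 * (2 * a + 1 : ℕ) : ℤ) < v i ∧ v i < 3 * (2 * a + 1 : ℕ) :=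
    fun v hv ↦ openConnIn_box_of_annulusBlocked hω (by omega) hB hxbox (openConnIn_univ_of_reachable hv)
  have hfin : (openCluster ω x).Finite := by
    refine (Finset.finite_toSet (box 2 (3 * (2 * a + 1)))).subset fun v hv ↦ ?_
    rw [Finset.mem_coe, mem_box]
    exact fun i ↦ ⟨(hconf v hv i).1.le, (hconf v hv i).2.le⟩
  obtain ⟨γ, hγ, htype, -, hwind, hloc⟩ := exists_isInterfaceLoop_around_openCluster hω hfin
  set u : UnbasedLoop ℂ := UnbasedLoop.mk (BasedLoop.mk (loopCurve δ 0 γ) (isLoop_loopCurve δ 0 hγ.ne_nil))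
    with hu
  have hrange : u.range = (fun w : ℂ ↦ (δ : ℂ) * w) '' (loopCurve 1 0 γ).range := by
    rw [hu, UnbasedLoop.range_mk, BasedLoop.toCurveClass_mk, loopCurve_eq_map_mul, CurveClass.range_map]
    rfl
  refine ⟨u, ⟨γ, hγ, htype, rfl⟩, ?_, ?_⟩
  · -- localisation: the mesh-`1` trace is within `1/2` of the cluster, inside `(-6a-3, 6a+3)²`
    rw [hrange]
    rintro _ ⟨z, hz, rfl⟩
    obtain ⟨v, hv, hdist⟩ := hloc z hz
    have hv' : -(6 * (a : ℤ) + 3) < v 0 ∧ v 0 < 6 * a + 3 ∧ -(6 * (a : ℤ) + 3) < v 1 ∧ v 1 < 6 * a + 3 := by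
      have h0 := hconf v hv 0
      have h1 := hconf v hv 1
      push_cast at h0 h1
      omega
    have hre : |(meshPoint 1 v).re| < 6 * a + 3 := by
      rw [meshPoint_re, one_mul, abs_lt]; exact ⟨by exact_mod_cast hv'.1, by exact_mod_cast hv'.2.1⟩
    have him : |(meshPoint 1 v).im| < 6 * a + 3 := by
      rw [meshPoint_im, one_mul, abs_lt]; exact ⟨by exact_mod_cast hv'.2.2.1, by exact_mod_cast hv'.2.2.2⟩
    have hnv : ‖meshPoint 1 v‖ < 12 * a + 6 :=
      lt_of_le_of_lt (Complex.norm_le_abs_re_add_abs_im _) (by linarith)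
    have hnz : ‖z‖ < 12 * a + 7 := by
      have := norm_le_norm_add_norm_sub' z (meshPoint 1 v)
      rw [← dist_eq_norm] at this
      linarith
    rw [mem_ball, dist_zero_right, norm_mul, Complex.norm_real, Real.norm_of_nonneg hδ.le]
    exact mul_lt_mul_of_pos_left hnz hδ
  · -- size: the loop winds once about `δx` and `δy`, which are at distance `≥ aδ`
    have hW : ∀ v ∈ openCluster ω x, (loopCurve δ 0 γ).wind (meshPoint δ v) = 1 := by
      intro v hv
      rw [wind_loopCurve_mesh hδ.ne' γ, ← hwind v hv]
      congr 1
      rw [meshPoint, meshPoint, Complex.ofReal_one, one_mul, mul_div_cancel_left₀ _ (Complex.ofReal_ne_zero.2 hδ.ne')]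
    have hnx : (loopCurve δ 0 γ).wind (meshPoint δ x) ≠ 0 := by rw [hW x (mem_openCluster_self ω x)]; exact one_ne_zero
    have hny : (loopCurve δ 0 γ).wind (meshPoint δ y) ≠ 0 := by rw [hW y hyC]; exact one_ne_zero
    have key := latticeDust_dist_le_two_mul_diam_range (loopCurve δ 0 γ) hnx hny
    have hdist : δ * a ≤ dist (meshPoint δ x) (meshPoint δ y) := by
      have h1 : |(meshPoint δ x - meshPoint δ y).re| ≤ ‖meshPoint δ x - meshPoint δ y‖ := Complex.abs_re_le_norm _
      rw [Complex.sub_re, meshPoint_re, meshPoint_re, hx0, hy0] at h1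
      rw [dist_eq_norm]
      refine le_trans (le_of_eq ?_) h1
      push_cast
      rw [show δ * (a : ℝ) - δ * (a + a) = -(δ * a) by ring, abs_neg, abs_of_nonneg (by positivity)]
    have hur : u.range = (loopCurve δ 0 γ).range := by
      rw [hu, UnbasedLoop.range_mk, BasedLoop.toCurveClass_mk]
    rw [hur]
    linarith

/-- **Registered anchor `latticeDust_bond_origin` — RSW dust input of bond-`ℤ²` about the origin.**
There is `p₀ ∈ (0, 1]` such that for every base scale `a₀ ≥ 1` and every `K`, off an event of
`P_{1/2}`-probability `≤ (1 - p₀)^K`, every lattice configuration carries, at every mesh `δ > 0`, a member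
of type `1` of `bondLoopConfig δ 0 ω` with trace in `B(0, 20 a₀ 16^K δ)` and diameter `≥ a₀ δ / 2` (the
scale-`a₀16^k` events of §1 at `k < K`, §2, and §3). -/
theorem latticeDust_bond_origin : ∃ p₀ : ℝ, 0 < p₀ ∧ p₀ ≤ 1 ∧ ∀ (a₀ K : ℕ), 1 ≤ a₀ →
    ∃ B : Set (BondConfig (Site 2)), MeasurableSet B ∧
      (bondPercolation (zdGraph 2) half).real B ≤ (1 - p₀) ^ K ∧
      ∀ ω ∉ B, ω ⊆ (zdGraph 2).edgeSet → ∀ δ : ℝ, 0 < δ →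
        ∃ u ∈ (bondLoopConfig δ 0 ω).F 1,
          u.range ⊆ ball (0 : ℂ) (δ * (20 * (a₀ * 16 ^ K))) ∧ δ * a₀ ≤ 2 * diam u.range := by
  obtain ⟨p₀, hp₀, hp₁, hp⟩ := latticeDust_exists_le_real_dustEv
  refine ⟨p₀, hp₀, hp₁, fun a₀ K ha₀ ↦ ⟨⋂ k ∈ Finset.range K, (DustEv(a₀ * 16 ^ k))ᶜ,
    latticeDust_measurableSet_iInter_compl a₀ K, latticeDust_real_iInter_compl_le hp ha₀ K, ?_⟩⟩
  intro ω hω hωE δ hδ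
  simp only [mem_iInter, mem_compl_iff, not_forall, not_not, exists_prop, Finset.mem_range] at hω
  obtain ⟨k, hk, hωk⟩ := hω
  have hpos : 1 ≤ a₀ * 16 ^ k := Nat.one_le_iff_ne_zero.2 (by positivity)
  obtain ⟨u, hu, hur, hud⟩ := latticeDust_typeOne_of_dustEv hωE hpos hωk hδ
  have hle : (a₀ * 16 ^ k : ℕ) ≤ (a₀ * 16 ^ K : ℝ) := by
    exact_mod_cast Nat.mul_le_mul_left a₀ (Nat.pow_le_pow_right (by norm_num) hk.le)
  have ha₀' : (a₀ : ℝ) ≤ (a₀ * 16 ^ k : ℕ) := by exact_mod_cast Nat.le_mul_of_pos_right a₀ (by positivity)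
  refine ⟨u, hu, hur.trans (ball_subset_ball ?_), le_trans ?_ hud⟩
  · have : (12 * (a₀ * 16 ^ k : ℕ) + 7 : ℝ) ≤ 20 * (a₀ * 16 ^ K) := by
      have h1 : (1 : ℝ) ≤ (a₀ * 16 ^ k : ℕ) := by exact_mod_cast hpos
      linarith
    exact mul_le_mul_of_nonneg_left this hδ.le
  · exact mul_le_mul_of_nonneg_left ha₀' hδ.le

end Summit.CriticalPhenomena.CardyFormulaZ2.Cruxes.NestingRigidity.PositiveConeWeightDoubling

end
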